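import Summits.KontsevichZagierPeriods.KontsevichZagierPeriods.Theorems.RootDecompQuadraticDescentPair18HomotopyEulerP1

/-! # `RootDecompQuadraticDescentPair18HomotopyEulerP2` — part 2/2 of the mechanical ≤400-line split of `Euler_landing.lean` (sha256 d960158e9d9003f9…)
Source: decomp-kz lens-6 g10 `Pair18HomotopyEuler.lean` (file #3; HOME/decomp-kz-lens-6/g10/, sha256 6270564a…; critic g5-19 CLEARED 20:2xZ «census pair #18 = THEOREM, no hypothesis left»): hEuler_holds : 3•[Ax0] − 2•[B11] ∈ KZ.relations — Euler's ζ(2) = π²/6 by regular moves (ϑ-family homotopy cell on □³ + Möbius/reflection/swap/squaring covs); landed by census-1 g9 over the landed file #1 (…Pair18HomotopyP01–P31): copied prelude dropped, Th7_eq/h7q renamed, pins removed.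
Split by census-1 g9 `gen/splitlean.py`: scopes re-opened with their `open`/`variable`/`set_option` context; mathematics and declaration order unchanged. -/

set_option linter.unusedSimpArgs false
noncomputable section
open _root_.Set MvPolynomial
namespace Summit.KontsevichZagierPeriods.RootDecompQuadraticDescent.Pair18Homotopy
open Literature.NumberTheory.Transcendental
open Literature.NumberTheory.Transcendental.KZ (RFun cube)
open Summit.KontsevichZagierPeriods.RootDecompQuadraticDescent.DarkPairs (rel_reflect_rep rel_double)
section Fold
open Literature.ModelTheory.ExponentialFields (IsSemialgebraic isSemialgebraic_setOf_eval_le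
  isSemialgebraic_setOf_eval_pos isSemialgebraic_setOf_eval_nonneg isSemialgebraic_setOf_eval_eq_zero)
open _root_.Set MvPolynomial in
open Literature.NumberTheory.Transcendental in
open Literature.NumberTheory.Transcendental.KZ (RFun cube) in
open Summit.KontsevichZagierPeriods.RootDecompQuadraticDescent.DarkPairs (rel_reflect_rep rel_double) in
/-- Auxiliary step `vec2_1` (§2b): vec2 1. [bookkeeping] -/
private theorem vec2_1 (a b : ℝ) : (![a, b] : Fin 2 → ℝ) 1 = b := rfl

open _root_.Set MvPolynomial in
open Literature.NumberTheory.Transcendental in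
open Literature.NumberTheory.Transcendental.KZ (RFun cube) in
open Summit.KontsevichZagierPeriods.RootDecompQuadraticDescent.DarkPairs (rel_reflect_rep rel_double) in
/-- Auxiliary step `vec2_0` (§2b): vec2 0. [bookkeeping] -/
private theorem vec2_0 (a b : ℝ) : (![a, b] : Fin 2 → ℝ) 0 = a := rfl

open _root_.Set MvPolynomial in
open Literature.NumberTheory.Transcendental in
open Literature.NumberTheory.Transcendental.KZ (RFun cube) in
open Summit.KontsevichZagierPeriods.RootDecompQuadraticDescent.DarkPairs (rel_reflect_rep rel_double) in
/-- Auxiliary step `cube2` (§0): cube2. [bookkeeping] -/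
private theorem cube2 {x : Fin 2 → ℝ} (hx : x ∈ KZ.cube 2) : (0 ≤ x 0 ∧ x 0 ≤ 1) ∧ (0 ≤ x 1 ∧ x 1 ≤ 1) := ⟨hx 0, hx 1⟩

namespace Euler

/-- Auxiliary step `R1_Bm1`: R1 Bm1. [bookkeeping] -/
theorem R1_Bm1 : KZ.of R1.rep - KZ.of Bm1.rep ∈ KZ.relations := by
  refine rel_moeb R1 Bm1 fun z hz => ?_
  obtain ⟨h0, h1⟩ := cube2 hz
  have ha : (0 : ℝ) < 1 + z 0 := by linarith
  have hane := ha.ne'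
  have hq : (0 : ℝ) < 1 + z 1 * z 1 := by nlinarith [mul_self_nonneg (z 1)]
  have hR : (0 : ℝ) < (1 + z 0) * (1 + z 0) + z 1 * z 1 * (1 - z 0) * (1 - z 0) := by
    nlinarith [mul_self_nonneg (z 1 * (1 - z 0))]
  have hqne := hq.ne'
  have hRne := hR.ne'
  simp only [R1, Bm1, R1Den, Bm1Den, RFun.fn, map_add, map_sub, map_mul, map_pow, map_neg, aeval_C, aeval_X,
    map_one, map_ofNat, eq_ratCast, Rat.cast_one, Rat.cast_ofNat, Rat.cast_div, Rat.cast_neg, vec2_0, vec2_1,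
    Matrix.cons_val_zero, Matrix.cons_val_one, Matrix.head_cons]
  have e2 : (1 : ℝ) + z 1 * z 1 * (1 - 2 * z 0 / (1 + z 0)) * (1 - 2 * z 0 / (1 + z 0)) =
      ((1 + z 0) * (1 + z 0) + z 1 * z 1 * (1 - z 0) * (1 - z 0)) / (1 + z 0) ^ 2 := by
    field_simp
    ring
  rw [e2]
  field_simp
  ring
/-- Auxiliary step `Bm1_BqS`: Bm1 Bq S. [bookkeeping] -/
theorem Bm1_BqS : KZ.of Bm1.rep - KZ.of BqS.rep ∈ KZ.relations := by
  refine rel_reflect 0 BqS Bm1 fun x hx => ?_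
  simp only [BqS, Bm1, BqSDen, Bm1Den, RFun.fn, map_add, map_sub, map_mul, map_pow, map_neg, aeval_C, aeval_X,
    map_one, map_ofNat, eq_ratCast, Rat.cast_one, Rat.cast_ofNat, Rat.cast_div, Rat.cast_neg, vec2_0, vec2_1,
    Matrix.cons_val_zero, Matrix.cons_val_one, Matrix.head_cons, Function.update_self,
    Function.update_of_ne (show (1 : Fin 2) ≠ 0 by decide)]
/-- Auxiliary step `BqS_Bq1`: Bq S Bq1. [bookkeeping] -/
theorem BqS_Bq1 : KZ.of BqS.rep - KZ.of (Bq 1 zero_le_one).rep ∈ KZ.relations := by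
  refine rel_swap BqS (Bq 1 zero_le_one) fun z hz => ?_
  simp only [BqS, Bq, BqSDen, BqDen, RFun.fn, map_add, map_sub, map_mul, map_pow, map_neg, aeval_C, aeval_X,
    map_one, map_ofNat, eq_ratCast, Rat.cast_one, Rat.cast_ofNat, Rat.cast_div, Rat.cast_neg, Rat.cast_mul,
    vec2_0, vec2_1, Matrix.cons_val_zero, Matrix.cons_val_one, Matrix.head_cons]
  ring
/-- **E3** `[R1] ≡ [B11]`. -/
theorem R1_B11 : KZ.of R1.rep - KZ.of B11.rep ∈ KZ.relations := by
  have hB : KZ.of (Bq 1 zero_le_one).rep - KZ.of B11.rep ∈ KZ.relations := Bq_Bbox 1 zero_le_one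
  have h := add_mem (add_mem (add_mem R1_Bm1 Bm1_BqS) BqS_Bq1) hB
  convert h using 1
  abel

end Euler

/-- **hEuler** (v14 hypothesis of `pair18_g8strips_of_grid`, now a theorem):
`3•[Ax0] − 2•[B11] ∈ KZ.relations` — `3·(π²/24) = 2·(π/4)²`, i.e. Euler's `ζ(2) = π²/6` inside the KZ rules. -/
theorem hEuler_holds : 3 • KZ.of Ax0.rep - 2 • KZ.of B11.rep ∈ KZ.relations := by
  have e : 3 • KZ.of Ax0.rep - 2 • KZ.of B11.rep =
      2 • (KZ.of U1.rep - KZ.of Euler.Q1.rep - KZ.of Euler.R1.rep) + 2 • (KZ.of Euler.R1.rep - KZ.of B11.rep)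
        - 2 • (KZ.of U1.rep - 2 • KZ.of Ax0.rep) - (KZ.of Ax0.rep - 2 • KZ.of Euler.Q1.rep) := by
    simp only [smul_sub, ← mul_nsmul']; abel
  rw [e]
  exact sub_mem (sub_mem (add_mem (KZ.relations.nsmul_mem Euler.rel 2) (KZ.relations.nsmul_mem Euler.R1_B11 2))
    (KZ.relations.nsmul_mem U1_Ax0 2)) Euler.Ax0_Q1

end Fold

end Summit.KontsevichZagierPeriods.RootDecompQuadraticDescent.Pair18Homotopy

end
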